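import Summits.HubbardSuperconductivity.HubbardSuperconductivity.Theorems.AnisotropyChordTransferFibre3TwoHoleGapReduce

/-!
# Route `AnisotropyChord` / H0 rotor rung: the CERTIFICATE INTERFACE for HOLE₂ at fixed `L` — `TwoHoleGapRealAt` from a Gram (LDLᵀ) factorisation

What a per-`L` (computational) certificate of HOLE₂ must deliver, in Lean terms (rung stmt-HubbardSuperconductivity-19089;
complements `…Fibre3TwoHoleGapReduce`, which reduces `TwoHoleGap L g` to the real single-pair inequality `TwoHoleGapRealAt L g 0 s`
for `≤ |Tor L ∖ 0| / 8` representatives `s`).  For the pair `(0, s)` and constants `ĝ, t`: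
* `siteW s x` / `bondW s x e`: the 0/1 weights of live sites / live ordered bonds; `holeMat s ĝ t` — the explicit symmetric matrix of
  the quadratic form `¼Σ_live bonds (u x − u y)² − ĝ Σ_live u² + t (Σ_live u)²` (`holeForm`), i.e. `Q − ĝI′ + tJ′`;
* ★ `holeForm_eq_quad`: `holeForm s ĝ t u = Σ_x Σ_y u x · holeMat s ĝ t x y · u y` (every `L`, every `s`);
* ★ `twoHoleGapRealAt_of_psd`: if the form of `holeMat s ĝ t` is non-negative then `TwoHoleGapRealAt L ĝ 0 s` (on mean-zero `u` the
  `t`-term vanishes);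
* `quad_nonneg_of_gram`: a Gram/`LDLᵀ` factorisation `holeMat = Σ_i d_i v_i ⊗ v_i`, `d_i ≥ 0`, gives non-negativity; the rational
  version `holeMatQ` (`ĝ, t ∈ ℚ`) with `holeMat_eq_cast`, and ★★ `twoHoleGapRealAt_of_ratCert`: a RATIONAL Gram certificate of
  `holeMatQ s ĝ t` (an identity a computational seat can check by `decide`) proves `TwoHoleGapRealAt L ĝ 0 s`;
* ★ `twoHoleGap_of_ratCerts`: orbit cover + rational certificates for the representatives + `¾ε₁ ≤ ĝ` ⇒ `TwoHoleGap L (¾ε₁)` = HOLE₂(.75) at that `L`.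
Numerics (scratch, exact arithmetic): at `L = 9`, `s = (1,1)`, `ĝ = 22/125 > ¾ε₁(9) = .17547`, `t = ĝ/79`, the exact `LDLᵀ` of
`holeMatQ` has all 79 pivots `≥ 0` (numerators ≤ 376 digits) — HOLE₂(.75) at `L = 9` is a finite identity check away.
Prover seat `hubbard-h0-rotor-p1` g24; helper for stmt-HubbardSuperconductivity-19089 (`--supports`).
-/

set_option linter.dupNamespace false
set_option autoImplicit false

noncomputable section

open scoped BigOperators
open Complex

namespace Summit.HubbardSuperconductivity.HubbardSuperconductivity.Theorems.AnisotropyChord.Transfer.Fibre3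

variable (L : ℕ) [NeZero L]

namespace TwoHoleCert

/-! ## The weights and the matrix -/

/-- live-site weight for the hole pair `(0, s)`: `0` on the holes, `1` elsewhere. [folklore] -/
def siteW (s x : Tor L) : ℚ := if (x = 0 ∨ x = s) then 0 else 1

/-- live ordered-bond weight for the hole pair `(0, s)` (bond `x → x + e`). [folklore] -/
def bondW (s x e : Tor L) : ℚ := if (x = 0 ∨ x = s ∨ x + e = 0 ∨ x + e = s) then 0 else 1

/-- live degree `Σ_e bondW`. [folklore] -/
def degW (s x : Tor L) : ℚ := bondW L s x (ex L) + bondW L s x (-ex L) + bondW L s x (ey L) + bondW L s x (-ey L)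

/-- the rational matrix `Q − ĝI′ + tJ′` of the two-hole form for the pair `(0, s)`:
`M x y = ½·deg(x)[x=y] − ½·Σ_e bondW(x,e)[y = x+e] − ĝ·siteW(x)[x=y] + t·siteW(x)siteW(y)`. [folklore] -/
def holeMatQ (s : Tor L) (ghat t : ℚ) (x y : Tor L) : ℚ :=
  (if x = y then degW L s x / 2 else 0)
    - ((if y = x + ex L then bondW L s x (ex L) else 0) + (if y = x + -ex L then bondW L s x (-ex L) else 0)
        + (if y = x + ey L then bondW L s x (ey L) else 0) + (if y = x + -ey L then bondW L s x (-ey L) else 0)) / 2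
    - (if x = y then ghat * siteW L s x else 0) + t * siteW L s x * siteW L s y

/-- the same matrix over `ℝ`. [folklore] -/
def holeMat (s : Tor L) (ghat t : ℚ) (x y : Tor L) : ℝ := (holeMatQ L s ghat t x y : ℝ)

/-- the two-hole quadratic form `¼Σ bondW (u x − u(x+e))² − ĝ Σ siteW u² + t (Σ siteW u)²`. [folklore] -/
def holeForm (s : Tor L) (ghat t : ℚ) (u : Tor L → ℝ) : ℝ :=
  (1 / 4 : ℝ) * (∑ x : Tor L, ((bondW L s x (ex L) : ℝ) * (u x - u (x + ex L)) ^ 2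
      + (bondW L s x (-ex L) : ℝ) * (u x - u (x + -ex L)) ^ 2 + (bondW L s x (ey L) : ℝ) * (u x - u (x + ey L)) ^ 2
      + (bondW L s x (-ey L) : ℝ) * (u x - u (x + -ey L)) ^ 2))
    - (ghat : ℝ) * (∑ x : Tor L, (siteW L s x : ℝ) * u x ^ 2) + (t : ℝ) * (∑ x : Tor L, (siteW L s x : ℝ) * u x) ^ 2

/-! ## The form as `uᵀ M u` -/

omit [NeZero L] in
/-- bond symmetry: the bond `(y − e) → y` is live iff the bond `y → y − e` is. [folklore] -/
theorem bondW_shift (s y e : Tor L) : bondW L s (y - e) e = bondW L s y (-e) := by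
  unfold bondW
  rw [sub_add_cancel, ← sub_eq_add_neg]
  by_cases h : (y = 0 ∨ y = s ∨ y - e = 0 ∨ y - e = s)
  · rw [if_pos h, if_pos (by tauto)]
  · rw [if_neg h, if_neg (by tauto)]

/-- reindexing the «arrival» squares: `Σ_x bondW(x,e) u(x+e)² = Σ_y bondW(y,−e) u(y)²`. [folklore] -/
theorem sum_bond_shift (s e : Tor L) (u : Tor L → ℝ) :
    ∑ x : Tor L, (bondW L s x e : ℝ) * u (x + e) ^ 2 = ∑ y : Tor L, (bondW L s y (-e) : ℝ) * u y ^ 2 := by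
  refine Fintype.sum_equiv (Equiv.addRight e) _ _ fun x => ?_
  simp only [Equiv.coe_addRight]
  rw [← bondW_shift L s (x + e) e, add_sub_cancel_right]

omit [NeZero L] in
/-- the matrix entries over `ℝ`, casts pushed inside. [folklore] -/
theorem holeMat_apply (s : Tor L) (ghat t : ℚ) (x y : Tor L) :
    holeMat L s ghat t x y
      = (if x = y then ((degW L s x : ℚ) : ℝ) / 2 else 0)
        - ((if y = x + ex L then ((bondW L s x (ex L) : ℚ) : ℝ) else 0)
            + (if y = x + -ex L then ((bondW L s x (-ex L) : ℚ) : ℝ) else 0)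
            + (if y = x + ey L then ((bondW L s x (ey L) : ℚ) : ℝ) else 0)
            + (if y = x + -ey L then ((bondW L s x (-ey L) : ℚ) : ℝ) else 0)) / 2
        - (if x = y then (ghat : ℝ) * (siteW L s x : ℝ) else 0) + (t : ℝ) * (siteW L s x : ℝ) * (siteW L s y : ℝ) := by
  unfold holeMat holeMatQ
  simp only [Rat.cast_add, Rat.cast_sub, Rat.cast_mul, Rat.cast_div, apply_ite (Rat.cast : ℚ → ℝ), Rat.cast_zero,
    Rat.cast_ofNat]

/-- a Kronecker row sum. [folklore] -/
theorem sum_ite_row (x : Tor L) (a : ℝ) (u : Tor L → ℝ) : ∑ y : Tor L, (if x = y then a else 0) * u y = a * u x := by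
  rw [Finset.sum_eq_single x (fun y _ hy => by rw [if_neg (Ne.symm hy), zero_mul]) (fun h => (h (Finset.mem_univ x)).elim)]
  rw [if_pos rfl]

/-- a shifted Kronecker row sum. [folklore] -/
theorem sum_ite_shift (x e : Tor L) (b : ℝ) (u : Tor L → ℝ) :
    ∑ y : Tor L, (if y = x + e then b else 0) * u y = b * u (x + e) := by
  rw [Finset.sum_eq_single (x + e) (fun y _ hy => by rw [if_neg hy, zero_mul]) (fun h => (h (Finset.mem_univ _)).elim)]
  rw [if_pos rfl]

/-- one row of `M u`. [folklore] -/
theorem holeMat_mulVec (s : Tor L) (ghat t : ℚ) (u : Tor L → ℝ) (x : Tor L) :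
    ∑ y : Tor L, holeMat L s ghat t x y * u y
      = ((degW L s x : ℚ) : ℝ) / 2 * u x
        - (((bondW L s x (ex L) : ℚ) : ℝ) * u (x + ex L) + ((bondW L s x (-ex L) : ℚ) : ℝ) * u (x + -ex L)
            + ((bondW L s x (ey L) : ℚ) : ℝ) * u (x + ey L) + ((bondW L s x (-ey L) : ℚ) : ℝ) * u (x + -ey L)) / 2
        - (ghat : ℝ) * (siteW L s x : ℝ) * u x + (t : ℝ) * (siteW L s x : ℝ) * ∑ y : Tor L, (siteW L s y : ℝ) * u y := by
  have hsummand : ∀ y : Tor L, holeMat L s ghat t x y * u y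
      = (if x = y then ((degW L s x : ℚ) : ℝ) / 2 else 0) * u y
        - ((if y = x + ex L then ((bondW L s x (ex L) : ℚ) : ℝ) else 0) * u y
            + (if y = x + -ex L then ((bondW L s x (-ex L) : ℚ) : ℝ) else 0) * u y
            + (if y = x + ey L then ((bondW L s x (ey L) : ℚ) : ℝ) else 0) * u y
            + (if y = x + -ey L then ((bondW L s x (-ey L) : ℚ) : ℝ) else 0) * u y) / 2
        - (if x = y then (ghat : ℝ) * (siteW L s x : ℝ) else 0) * u y
        + (t : ℝ) * (siteW L s x : ℝ) * ((siteW L s y : ℝ) * u y) := by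
    intro y; rw [holeMat_apply]; ring
  rw [Finset.sum_congr rfl (fun y _ => hsummand y)]
  simp only [Finset.sum_add_distrib, Finset.sum_sub_distrib, ← Finset.sum_div, ← Finset.mul_sum, sum_ite_row, sum_ite_shift]

/-- ★ **the two-hole form is `uᵀ M u`:** `holeForm s ĝ t u = Σ_x Σ_y u x · holeMat s ĝ t x y · u y`. [folklore] -/
theorem holeForm_eq_quad (s : Tor L) (ghat t : ℚ) (u : Tor L → ℝ) :
    holeForm L s ghat t u = ∑ x : Tor L, ∑ y : Tor L, u x * holeMat L s ghat t x y * u y := by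
  -- the right-hand side, row by row
  have hrow : ∀ x : Tor L, ∑ y : Tor L, u x * holeMat L s ghat t x y * u y
      = (1 / 2 : ℝ) * ((((bondW L s x (ex L) : ℚ) : ℝ) + ((bondW L s x (-ex L) : ℚ) : ℝ)
            + ((bondW L s x (ey L) : ℚ) : ℝ) + ((bondW L s x (-ey L) : ℚ) : ℝ)) * u x ^ 2)
        - (1 / 2 : ℝ) * (((bondW L s x (ex L) : ℚ) : ℝ) * (u x * u (x + ex L))
            + ((bondW L s x (-ex L) : ℚ) : ℝ) * (u x * u (x + -ex L))
            + ((bondW L s x (ey L) : ℚ) : ℝ) * (u x * u (x + ey L))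
            + ((bondW L s x (-ey L) : ℚ) : ℝ) * (u x * u (x + -ey L)))
        - (ghat : ℝ) * ((siteW L s x : ℝ) * u x ^ 2)
        + ((t : ℝ) * ∑ y : Tor L, (siteW L s y : ℝ) * u y) * ((siteW L s x : ℝ) * u x) := by
    intro x
    have h1 : ∑ y : Tor L, u x * holeMat L s ghat t x y * u y = u x * ∑ y : Tor L, holeMat L s ghat t x y * u y := by
      rw [Finset.mul_sum]; refine Finset.sum_congr rfl fun y _ => ?_; ring
    rw [h1, holeMat_mulVec]
    unfold degW
    push_cast
    ring
  rw [Finset.sum_congr rfl (fun x _ => hrow x)]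
  simp only [Finset.sum_add_distrib, Finset.sum_sub_distrib, ← Finset.mul_sum]
  -- the left-hand side: expand the squares and move the arrival squares back by `sum_bond_shift`
  have hA := sum_bond_shift L s (ex L) u
  have hB := sum_bond_shift L s (-ex L) u
  have hC := sum_bond_shift L s (ey L) u
  have hD := sum_bond_shift L s (-ey L) u
  rw [neg_neg] at hB hD
  unfold holeForm
  have hsq : ∀ x : Tor L,
      (bondW L s x (ex L) : ℝ) * (u x - u (x + ex L)) ^ 2 + (bondW L s x (-ex L) : ℝ) * (u x - u (x + -ex L)) ^ 2
        + (bondW L s x (ey L) : ℝ) * (u x - u (x + ey L)) ^ 2 + (bondW L s x (-ey L) : ℝ) * (u x - u (x + -ey L)) ^ 2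
      = (((bondW L s x (ex L) : ℚ) : ℝ) + ((bondW L s x (-ex L) : ℚ) : ℝ)
            + ((bondW L s x (ey L) : ℚ) : ℝ) + ((bondW L s x (-ey L) : ℚ) : ℝ)) * u x ^ 2
        + (((bondW L s x (ex L) : ℝ) * u (x + ex L) ^ 2 + (bondW L s x (-ex L) : ℝ) * u (x + -ex L) ^ 2)
            + ((bondW L s x (ey L) : ℝ) * u (x + ey L) ^ 2 + (bondW L s x (-ey L) : ℝ) * u (x + -ey L) ^ 2))
        - 2 * (((bondW L s x (ex L) : ℚ) : ℝ) * (u x * u (x + ex L))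
            + ((bondW L s x (-ex L) : ℚ) : ℝ) * (u x * u (x + -ex L))
            + ((bondW L s x (ey L) : ℚ) : ℝ) * (u x * u (x + ey L))
            + ((bondW L s x (-ey L) : ℚ) : ℝ) * (u x * u (x + -ey L))) := by
    intro x; ring
  rw [Finset.sum_congr rfl (fun x _ => hsq x)]
  simp only [Finset.sum_add_distrib, Finset.sum_sub_distrib, ← Finset.mul_sum]
  rw [hA, hB, hC, hD]
  -- the arrival squares now read `Σ (b₂ + b₁ + b₄ + b₃) u²`; collect
  have hcollect : (∑ x : Tor L, (bondW L s x (-ex L) : ℝ) * u x ^ 2 + ∑ x : Tor L, (bondW L s x (ex L) : ℝ) * u x ^ 2)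
      + (∑ x : Tor L, (bondW L s x (-ey L) : ℝ) * u x ^ 2 + ∑ x : Tor L, (bondW L s x (ey L) : ℝ) * u x ^ 2)
      = ∑ x : Tor L, (((bondW L s x (ex L) : ℚ) : ℝ) + ((bondW L s x (-ex L) : ℚ) : ℝ)
            + ((bondW L s x (ey L) : ℚ) : ℝ) + ((bondW L s x (-ey L) : ℚ) : ℝ)) * u x ^ 2 := by
    rw [← Finset.sum_add_distrib, ← Finset.sum_add_distrib, ← Finset.sum_add_distrib]
    refine Finset.sum_congr rfl fun x _ => ?_; ring
  rw [hcollect]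
  ring

/-! ## From positivity of the form to the single-pair inequality -/

/-- ★ **PSD ⇒ the pair inequality:** if `uᵀ (holeMat s ĝ t) u ≥ 0` for every real `u` then `TwoHoleGapRealAt L ĝ 0 s`. [folklore] -/
theorem twoHoleGapRealAt_of_psd (s : Tor L) (ghat t : ℚ)
    (hM : ∀ u : Tor L → ℝ, 0 ≤ ∑ x : Tor L, ∑ y : Tor L, u x * holeMat L s ghat t x y * u y) :
    TwoHoleGapRealAt L (ghat : ℝ) 0 s := by
  intro u hmean
  have hq := hM u
  rw [← holeForm_eq_quad] at hq
  unfold holeForm at hq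
  -- the mean and mass sums of `TwoHoleGapRealAt` versus the weighted sums
  have hm : ∑ x : Tor L, (siteW L s x : ℝ) * u x = ∑ x : Tor L, (if (x = 0 ∨ x = s) then (0 : ℝ) else u x) := by
    refine Finset.sum_congr rfl fun x _ => ?_
    unfold siteW; split_ifs <;> simp
  have hmass : ∑ x : Tor L, (siteW L s x : ℝ) * u x ^ 2 = ∑ x : Tor L, (if (x = 0 ∨ x = s) then (0 : ℝ) else u x ^ 2) := by
    refine Finset.sum_congr rfl fun x _ => ?_
    unfold siteW; split_ifs <;> simp
  have hbond : ∑ x : Tor L, ((bondW L s x (ex L) : ℝ) * (u x - u (x + ex L)) ^ 2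
      + (bondW L s x (-ex L) : ℝ) * (u x - u (x + -ex L)) ^ 2 + (bondW L s x (ey L) : ℝ) * (u x - u (x + ey L)) ^ 2
      + (bondW L s x (-ey L) : ℝ) * (u x - u (x + -ey L)) ^ 2)
      = ∑ x : Tor L, ((nnList L).map (fun e =>
          if (x = 0 ∨ x = s ∨ x + e = 0 ∨ x + e = s) then (0 : ℝ) else (u x - u (x + e)) ^ 2)).sum := by
    refine Finset.sum_congr rfl fun x _ => ?_
    rw [nnList_map_sum]
    unfold bondW
    split_ifs <;> push_cast <;> ring
  rw [hm, hmean, hmass, hbond] at hq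
  have h0 : (0 : ℝ) ^ 2 = 0 := by norm_num
  rw [h0, mul_zero, add_zero] at hq
  linarith

/-- a Gram factorisation `M = Σ_i d_i v_i ⊗ v_i` with `d_i ≥ 0` makes the form non-negative. [folklore] -/
theorem quad_nonneg_of_gram {ι : Type*} [Fintype ι] (M : Tor L → Tor L → ℝ) (d : ι → ℝ) (hd : ∀ i, 0 ≤ d i)
    (v : ι → Tor L → ℝ) (hM : ∀ x y : Tor L, M x y = ∑ i, d i * v i x * v i y) (u : Tor L → ℝ) :
    0 ≤ ∑ x : Tor L, ∑ y : Tor L, u x * M x y * u y := by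
  have h1 : ∀ x y : Tor L, u x * M x y * u y = ∑ i, d i * ((v i x * u x) * (v i y * u y)) := by
    intro x y
    rw [hM, Finset.mul_sum, Finset.sum_mul]
    exact Finset.sum_congr rfl fun i _ => by ring
  have key : ∑ x : Tor L, ∑ y : Tor L, u x * M x y * u y = ∑ i, d i * (∑ x : Tor L, v i x * u x) ^ 2 := by
    calc ∑ x : Tor L, ∑ y : Tor L, u x * M x y * u y
        = ∑ x : Tor L, ∑ y : Tor L, ∑ i, d i * ((v i x * u x) * (v i y * u y)) := by simp only [h1]
      _ = ∑ x : Tor L, ∑ i, ∑ y : Tor L, d i * ((v i x * u x) * (v i y * u y)) :=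
          Finset.sum_congr rfl fun x _ => Finset.sum_comm
      _ = ∑ i, ∑ x : Tor L, ∑ y : Tor L, d i * ((v i x * u x) * (v i y * u y)) := Finset.sum_comm
      _ = ∑ i, d i * (∑ x : Tor L, v i x * u x) ^ 2 := by
          refine Finset.sum_congr rfl fun i _ => ?_
          rw [sq, Finset.sum_mul_sum, Finset.mul_sum]
          refine Finset.sum_congr rfl fun x _ => ?_
          rw [Finset.mul_sum]
  rw [key]
  exact Finset.sum_nonneg fun i _ => mul_nonneg (hd i) (sq_nonneg _)

/-- ★★ **a RATIONAL Gram certificate proves the pair inequality:** if `holeMatQ s ĝ t = Σ_i d_i v_i ⊗ v_i` over `ℚ` with `d_i ≥ 0`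
(a finite identity, checkable by `decide` at fixed `L`), then `TwoHoleGapRealAt L ĝ 0 s`. [folklore] -/
theorem twoHoleGapRealAt_of_ratCert {ι : Type*} [Fintype ι] (s : Tor L) (ghat t : ℚ) (d : ι → ℚ) (hd : ∀ i, 0 ≤ d i)
    (v : ι → Tor L → ℚ) (hM : ∀ x y : Tor L, holeMatQ L s ghat t x y = ∑ i, d i * v i x * v i y) :
    TwoHoleGapRealAt L (ghat : ℝ) 0 s := by
  refine twoHoleGapRealAt_of_psd L s ghat t (quad_nonneg_of_gram L (holeMat L s ghat t) (fun i => (d i : ℝ))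
    (fun i => by exact_mod_cast hd i) (fun i x => (v i x : ℝ)) fun x y => ?_)
  unfold holeMat
  rw [hM x y]
  push_cast
  rfl

/-- ★ **HOLE₂(.75) at fixed `L` from certificates:** an orbit cover `S`, a rational Gram certificate of `holeMatQ s ĝ (t s)` for
each `s ∈ S`, and `¾ε₁ ≤ ĝ` give `TwoHoleGap L (¾ε₁)`. [folklore] -/
theorem twoHoleGap_of_ratCerts (ghat : ℚ) (hg : 3 / 4 * eps1 L ≤ (ghat : ℝ)) (S : Finset (Tor L))
    (hcover : ∀ z : Tor L, z ≠ 0 → ∃ s ∈ S, s ∈ d4Orbit L z)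
    (hcert : ∀ s ∈ S, TwoHoleGapRealAt L (ghat : ℝ) 0 s) : TwoHoleGap L (3 / 4 * eps1 L) :=
  twoHoleGap_mono L hg (twoHoleGap_of_reps L S hcover hcert)

end TwoHoleCert

end Summit.HubbardSuperconductivity.HubbardSuperconductivity.Theorems.AnisotropyChord.Transfer.Fibre3

end
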